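import Literature.NumberTheory.GaloisRepresentations.CohomologicalDimension
import Literature.NumberTheory.GaloisRepresentations.ContinuousCohomologyVanishing
import Literature.NumberTheory.GaloisRepresentations.ContinuousCohomologyCoinduced
import Literature.NumberTheory.GaloisRepresentations.DiscreteCochains
import Literature.NumberTheory.GaloisRepresentations.ProfiniteCrossSection
import Literature.NumberTheory.GaloisRepresentations.CoinducedModule
import HarnessLib

/-!
# Proof of the Tower Theorem `cd_p(G) ≤ cd_p(N) + cd_p(G/N)` (Shatz III §1 Thm. 13)

This file discharges the named fact
`Literature.NumberTheory.GaloisRepresentations.tower_groupCdLE_of_isClosed_normal`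
(`CohomologicalDimension.lean`): for a profinite group `G`, a closed normal subgroup `N` and a
prime `p`, `cd_p(N) ≤ a → cd_p(G/N) ≤ b → cd_p(G) ≤ a + b` (Shatz, *Profinite groups,
arithmetic, and geometry*, Ch. III §1 Thm. 13 "Tower Theorem"; Serre, *Cohomologie galoisienne*,
I §3.3 Prop. 15), for Mathlib's continuous cohomology `continuousCohomology` of discrete
`p`-primary modules.

## Proof

The printed proof is the Hochschild–Serre spectral sequence `H^i(G/N, H^j(N, A)) ⇒ H^{i+j}(G, A)`
with `E₂^{ij} = 0` for `i > b` or `j > a`. Mathlib has no spectral sequences; we run the same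
argument as an induction by **dimension shifting** (Shatz II §2 Prop. 6, Serre I §2.5), which only
uses the rows/columns of `E₂` through the following ingredients, all proved in the imported files:

1. `I(M) = C(G, M) ⊇ M` (Mathlib `coind₁`) is a discrete `p`-primary `G`-module with quotient
   `Q(M)`, and `Hⁿ(G, I(M)) = 0` for `n ≥ 1` (`ContinuousCohomologyCoinduced`).
2. The long exact sequence pieces for `0 → M → I → Q → 0` over `G`, over `N` and — on invariants
   `0 → M^N → I^N → Q^N → 0`, exact when `H¹(N, M) = 0` — over `G/N` (`DiscreteCochains`,
   `ContinuousCohomologyVanishing`).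
3. `I(M)` is `N`-acyclic: by the **cross-section theorem** (Shatz I §2 Thm. 3,
   `ProfiniteCrossSection`) `G ≃ₜ N × G/N` `N`-equivariantly, so `I(M)|_N ≅ coind₁^N C(G/N, M)`
   (`coindRestrictIso`); and `I(M)^N ≅ coind₁^{G/N}(M)` is `G/N`-acyclic
   (`coindInvariantsIso`).
4. Base case `a = 0` (the degenerate spectral sequence, Shatz II §4 (25)): for `N`-acyclic `M`,
   `H^{k+1}(G/N, M^N) = 0 ⇒ H^{k+1}(G, M) = 0` by induction on `k`, shifting `M ↦ Q(M)` on both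
   sides (`subsingleton_of_nAcyclic`); then induction on `a`, shifting `M ↦ Q(M)` which lowers the
   `N`-cohomological amplitude by one (`subsingleton_of_cdN`).

## References

* S. S. Shatz, *Profinite groups, arithmetic, and geometry*, Ann. of Math. Studies 67 (1972),
  Ch. I §2 Thm. 3; Ch. II §1 Prop. 3, §2 Prop. 6, Thm. 8, §4 (24)–(25); Ch. III §1 Thm. 13.
  [Shatz1972]
* J.-P. Serre, *Cohomologie galoisienne*, 5e éd., Springer LNM 5 (1994; English translation
  *Galois Cohomology*, 1997), I §1.2 Prop. 1, §2.5, §2.6, §3.3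
  Prop. 15. [SerreGaloisCohomology1997]
-/

noncomputable section

open CategoryTheory Limits Topology
open scoped Pointwise

universe u

namespace Literature.NumberTheory.GaloisRepresentations

open _root_.TopRep _root_.ContRepresentation _root_.ContinuousCohomology

/-! ### `p`-primary torsion is inherited by the modules of dimension shifting -/

section PrimaryTorsion

variable {p : ℕ}

/-- A submodule of a `p`-primary torsion group is `p`-primary torsion. [folklore] -/
theorem IsPrimaryTorsion.submodule {A : Type*} [Ring A] {M : Type*} [AddCommGroup M] [Module A M]
    (h : IsPrimaryTorsion p M) (W : Submodule A M) : IsPrimaryTorsion p W := fun m => by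
  obtain ⟨r, hr⟩ := h m
  exact ⟨r, Subtype.ext (by simpa using hr)⟩

/-- A quotient of a `p`-primary torsion group is `p`-primary torsion. [folklore] -/
theorem IsPrimaryTorsion.quotient {A : Type*} [Ring A] {M : Type*} [AddCommGroup M] [Module A M]
    (h : IsPrimaryTorsion p M) (W : Submodule A M) : IsPrimaryTorsion p (M ⧸ W) := fun q => by
  induction q using Submodule.Quotient.induction_on with
  | _ m =>
    obtain ⟨r, hr⟩ := h m
    refine ⟨r, ?_⟩
    have := congrArg W.mkQ hr
    rwa [map_nsmul, map_zero] at this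

/-- Continuous functions from a compact space to a discrete `p`-primary torsion group form a
`p`-primary torsion group (finitely many values; Shatz II §2, proof of Prop. 6: "`π_*B` is a
torsion module if `B` is"). [cite: Shatz1972, Ch. II §2 Prop. 6 (proof)] -/
theorem IsPrimaryTorsion.continuousMap {X : Type*} [TopologicalSpace X] [CompactSpace X]
    {M : Type*} [AddCommGroup M] [TopologicalSpace M] [DiscreteTopology M]
    (h : IsPrimaryTorsion p M) : IsPrimaryTorsion p C(X, M) := fun f => by
  classical
  have hfin := finite_range_of_compact_discrete f
  choose r hr using h
  refine ⟨hfin.toFinset.sup r, ?_⟩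
  ext x
  have hx : f x ∈ hfin.toFinset := hfin.mem_toFinset.2 ⟨x, rfl⟩
  obtain ⟨d, hd⟩ := Nat.exists_eq_add_of_le (Finset.le_sup (f := r) hx)
  rw [ContinuousMap.smul_apply, ContinuousMap.zero_apply, hd, pow_add, mul_comm, mul_smul, hr,
    smul_zero]

end PrimaryTorsion

/-! ### Setting: a compact group, a closed normal subgroup, a discrete module -/

section Setting

variable {G : Type u} [Group G] [TopologicalSpace G] [IsTopologicalGroup G] [CompactSpace G]

variable {M : Type u} [AddCommGroup M] [TopologicalSpace M] [DiscreteTopology M]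
variable {M' : Type u} [AddCommGroup M'] [TopologicalSpace M'] [DiscreteTopology M']

/-- Restriction of a morphism of discrete `G`-modules to a subgroup `N`. [folklore] -/
def restrictHom (N : Subgroup G) {ρ : ContinuousRep G ℤ M} {ρ' : ContinuousRep G ℤ M'}
    (f : ρ.toTopRep ⟶ ρ'.toTopRep) :
    (ρ.restrict (subgroupIncl N)).toTopRep ⟶ (ρ'.restrict (subgroupIncl N)).toTopRep :=
  TopRep.ofHom ⟨f.hom.toContinuousLinearMap, fun n => f.hom.isIntertwining' (n : G)⟩

omit [IsTopologicalGroup G] [CompactSpace G] in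
/-- `restrictHom` is `f` on elements. [folklore] -/
@[simp] theorem restrictHom_hom_apply (N : Subgroup G) {ρ : ContinuousRep G ℤ M}
    {ρ' : ContinuousRep G ℤ M'} (f : ρ.toTopRep ⟶ ρ'.toTopRep) (m : M) :
    (restrictHom N f).hom m = f.hom m := rfl

variable (N : Subgroup G) [N.Normal] (ρ : ContinuousRep G ℤ M)

/-- The dimension-shifting sequence `0 → M → C(G, M) → Q → 0` is short exact. [folklore] -/
theorem isSES_coind : IsSES ρ.coindι ρ.coindπ :=
  ⟨ρ.coindι_comp_coindπ, ρ.coindι_injective, ρ.coind_exact_mid, ρ.coindπ_surjective⟩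

omit [N.Normal] in
/-- Its restriction to `N` is short exact. [folklore] -/
theorem isSES_coind_restrict [CompactSpace N] :
    IsSES (restrictHom N ρ.coindι) (restrictHom N ρ.coindπ) :=
  ⟨by ext m; exact congr(($(ρ.coindι_comp_coindπ)).hom m), ρ.coindι_injective, ρ.coind_exact_mid,
    ρ.coindπ_surjective⟩

end Setting

/-! ### `C(G, M)` is `N`-acyclic: restriction to `N` via a cross-section -/

section Restrict

variable {G : Type u} [Group G] [TopologicalSpace G] [IsTopologicalGroup G] [CompactSpace G]
  [T2Space G]
variable (N : Subgroup G) [N.Normal] [hN : IsClosed (N : Set G)]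
variable {M : Type u} [AddCommGroup M] [TopologicalSpace M] [DiscreteTopology M]
variable (ρ : ContinuousRep G ℤ M)

/-- A closed subgroup of a compact group is compact. [folklore] -/
instance compactSpace_subgroup : CompactSpace N := isCompact_iff_compactSpace.mp hN.isCompact

/-- The `N`-module `C(G ⧸ N, M)` with `N` acting on the values through `ρ` (no action on the
argument). [folklore] -/
def postcompRep : ContRepresentation ℤ N C(G ⧸ N, M) :=
  ContRepresentation.ofMonoidHom
    { toFun := fun n =>
        ContinuousLinearMap.compLeftContinuous ℤ (G ⧸ N) (ρ.toContRepresentation (n : G))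
      map_one' := by ext z c; simp
      map_mul' := fun n n' => by ext z c; simp }

omit [IsTopologicalGroup G] [CompactSpace G] [T2Space G] [N.Normal] hN in
/-- Unfolding `postcompRep`. [folklore] -/
@[simp] theorem postcompRep_apply_apply (n : N) (z : C(G ⧸ N, M)) (c : G ⧸ N) :
    postcompRep N ρ n z c = ρ (n : G) (z c) := rfl

variable (s : G ⧸ N → G) (hs : Continuous s) (hsec : ∀ c, (QuotientGroup.mk (s c) : G ⧸ N) = c)
  (hsN : ∀ x : G, (s (x : G ⧸ N))⁻¹ * x ∈ N)

omit [TopologicalSpace G] [IsTopologicalGroup G] [CompactSpace G] [T2Space G] hN in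
/-- Left multiplication by an element of the normal subgroup does not change the coset.
[folklore] -/
theorem mk_subgroup_mul (n : N) (y : G) : (QuotientGroup.mk ((n : G) * y) : G ⧸ N) = y := by
  rw [QuotientGroup.eq, mul_inv_rev]
  simpa using Subgroup.Normal.conj_mem inferInstance _ (N.inv_mem n.2) y⁻¹

include hsN in
omit [TopologicalSpace G] [IsTopologicalGroup G] [CompactSpace G] [T2Space G] hN in
/-- The `N`-coordinate `x (s x̄)⁻¹ ∈ N` of `x` with respect to the section `s`. [folklore] -/
theorem mul_section_inv_mem (x : G) : x * (s (x : G ⧸ N))⁻¹ ∈ N :=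
  Subgroup.Normal.mem_comm inferInstance (hsN x)

/-- The `N`-coordinate map `G → N`, `x ↦ x (s x̄)⁻¹`. [folklore] -/
def nCoord (x : G) : N := ⟨x * (s (x : G ⧸ N))⁻¹, mul_section_inv_mem N s hsN x⟩

omit [TopologicalSpace G] [IsTopologicalGroup G] [CompactSpace G] [T2Space G] hN in
/-- Value of `nCoord`. [folklore] -/
@[simp] theorem coe_nCoord (x : G) : (nCoord N s hsN x : G) = x * (s (x : G ⧸ N))⁻¹ := rfl

include hs in
omit [CompactSpace G] [T2Space G] hN in
/-- `nCoord` is continuous. [folklore] -/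
theorem continuous_nCoord : Continuous (nCoord N s hsN) :=
  (continuous_id.mul (hs.comp QuotientGroup.continuous_mk).inv).subtype_mk _

/-- **`C(G, M)|_N ≅ coind₁^N C(G ⧸ N, M)`**: along a continuous section `s` of `G → G ⧸ N`,
`F ↦ (m ↦ c ↦ F (m · s c))` identifies the restriction to `N` of the coinduced module
`C(G, M)` (twisted action) with the coinduced `N`-module of `C(G ⧸ N, M)` (values acted on
through `ρ`); inverse `H ↦ (x ↦ H (x (s x̄)⁻¹) x̄)`. All spaces are discrete (compactness), so
only the algebra needs checking. [cite: Shatz1972, Ch. I §2 Thm. 3 and Ch. II §2 (induced modules)] -/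
def coindRestrictEquiv : C(G, M) ≃L[ℤ] C(N, C(G ⧸ N, M)) where
  toFun F :=
    ⟨fun m => ⟨fun c => F ((m : G) * s c), F.continuous.comp (continuous_const.mul hs)⟩,
      ContinuousMap.continuous_of_continuous_uncurry _
        (F.continuous.comp ((continuous_subtype_val.comp continuous_fst).mul
          (hs.comp continuous_snd)))⟩
  invFun H :=
    ⟨fun x => H (nCoord N s hsN x) (x : G ⧸ N),
      (H.continuous.comp (continuous_nCoord N s hs hsN)).eval QuotientGroup.continuous_mk⟩
  map_add' F F' := by ext m c; rfl
  map_smul' r F := by ext m c; rfl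
  left_inv F := by
    ext x
    change F ((x * (s (x : G ⧸ N))⁻¹) * s (x : G ⧸ N)) = F x
    rw [inv_mul_cancel_right]
  right_inv H := by
    ext m c
    have h1 : (QuotientGroup.mk ((m : G) * s c) : G ⧸ N) = c := by rw [mk_subgroup_mul, hsec]
    have h2 : nCoord N s hsN ((m : G) * s c) = m := Subtype.ext (by
      rw [coe_nCoord, h1, mul_inv_cancel_right])
    change H (nCoord N s hsN ((m : G) * s c)) (QuotientGroup.mk ((m : G) * s c)) = H m c
    rw [h2, h1]
  continuous_toFun := continuous_of_discreteTopology
  continuous_invFun := continuous_of_discreteTopology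

/-- The isomorphism of topological `N`-representations
`C(G, M)|_N ≅ coind₁ (C(G ⧸ N, M))`. [folklore] -/
def coindRestrictIso :
    (ρ.coind.restrict (subgroupIncl N)).toTopRep ≅ coind₁ (TopRep.of (postcompRep N ρ)) :=
  topRepIsoOfEquiv (coindRestrictEquiv N s hs hsec hsN) fun n F => by
    ext m c
    change ρ.coind (n : G) F ((m : G) * s c) =
      ρ (n : G) (F (((n⁻¹ * m : N) : G) * s c))
    rw [ContinuousRep.coind_apply_apply, Subgroup.coe_mul, Subgroup.coe_inv, mul_assoc]

variable [TotallyDisconnectedSpace G]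

omit s hs hsec hsN in
/-- **The coinduced module `C(G, M)` is `N`-acyclic** for a closed normal subgroup `N` of a
profinite group `G`: `Hⁿ⁺¹(N, C(G, M)|_N) = 0` (cross-section theorem + acyclicity of `coind₁`).
[cite: Shatz1972, Ch. II §2 Thm. 8 with Ch. I §2 Thm. 3] -/
theorem subsingleton_coind_restrict (n : ℕ) :
    Subsingleton (continuousCohomology (n + 1) ((ρ.coind.restrict (subgroupIncl N)).toTopRep)) := by
  obtain ⟨s, hs, hsec, hsN⟩ := exists_continuous_section_mem N hN
  haveI := subsingleton_continuousCohomology_coind₁ (TopRep.of (postcompRep N ρ)) n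
  exact subsingleton_continuousCohomology_of_iso (coindRestrictIso N ρ s hs hsec hsN).symm (n + 1)

end Restrict

/-! ### The invariants `C(G, M)^N` as a `G ⧸ N`-module, and the sequence of invariants -/

section Invariants

variable {G : Type u} [Group G] [TopologicalSpace G] [IsTopologicalGroup G] [CompactSpace G]
  [T2Space G]
variable (N : Subgroup G) [N.Normal] [hN : IsClosed (N : Set G)]
variable {M : Type u} [AddCommGroup M] [TopologicalSpace M] [DiscreteTopology M]
variable (ρ : ContinuousRep G ℤ M)

omit [T2Space G] hN in
/-- An `N`-invariant element `F` of `C(G, M)` satisfies `F (x n) = ρ (x n x⁻¹) (F x)`.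
[folklore] -/
theorem apply_mul_of_mem_invariantsOf (F : ρ.coind.invariantsOf N) (x : G) (n : G) (hn : n ∈ N) :
    (F.1 : C(G, M)) (x * n) = ρ (x * n * x⁻¹) ((F.1 : C(G, M)) x) := by
  have h := congr($(F.2 ⟨x * n * x⁻¹, Subgroup.Normal.conj_mem inferInstance n hn x⟩) (x * n))
  change ρ.coind (x * n * x⁻¹) F.1 (x * n) = (F.1 : C(G, M)) (x * n) at h
  rw [ContinuousRep.coind_apply_apply] at h
  rw [← h]
  congr 2
  group

/-- **`C(G, M)^N ≅ C(G ⧸ N, M)`** as abelian groups: `F ↦ (x̄ ↦ ρ(x)⁻¹ F(x))` (well defined by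
`N`-invariance), inverse `H ↦ (x ↦ ρ(x) H(x̄))`; both sides are discrete. [folklore] -/
def coindInvariantsEquiv : ρ.coind.invariantsOf N ≃L[ℤ] C(G ⧸ N, M) where
  toFun F :=
    ⟨Quotient.lift (fun x : G => ρ x⁻¹ ((F.1 : C(G, M)) x)) fun x y hxy => by
        replace hxy : x⁻¹ * y ∈ N := QuotientGroup.leftRel_apply.mp hxy
        obtain ⟨n, hn, rfl⟩ : ∃ n ∈ N, y = x * n := ⟨x⁻¹ * y, hxy, by group⟩
        change ρ x⁻¹ ((F.1 : C(G, M)) x) = ρ (x * n)⁻¹ ((F.1 : C(G, M)) (x * n))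
        rw [apply_mul_of_mem_invariantsOf N ρ F x n hn, ← Module.End.mul_apply, ← map_mul]
        congr 2
        group,
      by
        rw [(QuotientGroup.isQuotientMap_mk N).continuous_iff]
        exact ρ.continuous_apply₂.comp (continuous_inv.prodMk (F.1 : C(G, M)).continuous)⟩
  invFun H :=
    ⟨⟨fun x => ρ x (H (x : G ⧸ N)),
        ρ.continuous_apply₂.comp (continuous_id.prodMk (H.continuous.comp
          QuotientGroup.continuous_mk))⟩, fun n => by
      ext x
      change ρ (n : G) (ρ ((n : G)⁻¹ * x) (H (((n : G)⁻¹ * x : G) : G ⧸ N))) = ρ x (H (x : G ⧸ N))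
      rw [← Module.End.mul_apply, ← map_mul, mul_inv_cancel_left, ← Subgroup.coe_inv,
        mk_subgroup_mul]⟩
  map_add' F F' := by
    ext ⟨x⟩
    change ρ x⁻¹ ((F.1 : C(G, M)) x + (F'.1 : C(G, M)) x) =
      ρ x⁻¹ ((F.1 : C(G, M)) x) + ρ x⁻¹ ((F'.1 : C(G, M)) x)
    rw [map_add]
  map_smul' r F := by
    ext ⟨x⟩
    change ρ x⁻¹ (r • (F.1 : C(G, M)) x) = r • ρ x⁻¹ ((F.1 : C(G, M)) x)
    rw [map_zsmul]
  left_inv F := by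
    apply Subtype.ext
    ext x
    change ρ x (ρ x⁻¹ ((F.1 : C(G, M)) x)) = (F.1 : C(G, M)) x
    rw [← Module.End.mul_apply, ← map_mul, mul_inv_cancel, map_one, Module.End.one_apply]
  right_inv H := by
    ext ⟨x⟩
    change ρ x⁻¹ (ρ x (H (x : G ⧸ N))) = H (x : G ⧸ N)
    rw [← Module.End.mul_apply, ← map_mul, inv_mul_cancel, map_one, Module.End.one_apply]
  continuous_toFun := continuous_of_discreteTopology
  continuous_invFun := continuous_of_discreteTopology

/-- **`C(G, M)^N ≅ coind₁^{G/N}(M)`** as topological `G ⧸ N`-representations, where `M` carries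
the trivial `G ⧸ N`-action (so the right-hand side is `C(G ⧸ N, M)` with `G ⧸ N` translating the
argument); hence `C(G, M)^N` is `G ⧸ N`-acyclic. [cite: Shatz1972, Ch. II §2 Thm. 8 and §4 (24)–(25)] -/
def coindInvariantsIso :
    (ρ.coind.quotientInvariants N).toTopRep ≅
      coind₁ (TopRep.of (ContRepresentation.trivial ℤ (G ⧸ N) M)) :=
  topRepIsoOfEquiv (coindInvariantsEquiv N ρ) fun c F => by
    induction c using QuotientGroup.induction_on with
    | H g =>
      ext ⟨x⟩
      change ρ x⁻¹ (ρ.coind g F.1 x) = ρ (g⁻¹ * x)⁻¹ ((F.1 : C(G, M)) (g⁻¹ * x))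
      rw [ContinuousRep.coind_apply_apply, ← Module.End.mul_apply, ← map_mul, mul_inv_rev,
        inv_inv]

omit hN in
/-- `Hⁿ⁺¹(G ⧸ N, C(G, M)^N) = 0`. [cite: Shatz1972, Ch. II §2 Thm. 8] -/
theorem subsingleton_coind_invariants (n : ℕ) :
    Subsingleton (continuousCohomology (n + 1) (ρ.coind.quotientInvariants N).toTopRep) := by
  haveI := subsingleton_continuousCohomology_coind₁
    (TopRep.of (ContRepresentation.trivial ℤ (G ⧸ N) M)) n
  exact subsingleton_continuousCohomology_of_iso (coindInvariantsIso N ρ).symm (n + 1)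

variable [TotallyDisconnectedSpace G]

/-- **The sequence of invariants `0 → M^N → C(G, M)^N → Q^N → 0` is short exact when
`H¹(N, M) = 0`** (exactness of `H⁰(N, C(G,M)) → H⁰(N, Q) → H¹(N, M)`).
[cite: Shatz1972, Ch. II §1 Prop. 3] -/
theorem isSES_invariants
    (h1 : Subsingleton (continuousCohomology 1 ((ρ.restrict (subgroupIncl N)).toTopRep))) :
    IsSES (ContinuousRep.invariantsHom (N := N) ρ.coindι)
      (ContinuousRep.invariantsHom (N := N) ρ.coindπ) := by
  refine ⟨?_, ?_, ?_, ?_⟩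
  · ext ⟨m, hm⟩
    exact congr(($(ρ.coindι_comp_coindπ)).hom m)
  · exact fun a b h => Subtype.ext (ρ.coindι_injective (congrArg Subtype.val h))
  · rintro ⟨y, hy⟩ h
    obtain ⟨m, hm⟩ := ρ.coind_exact_mid y (congrArg Subtype.val h)
    refine ⟨⟨m, fun n => ρ.coindι_injective ?_⟩, Subtype.ext hm⟩
    refine (TopRep.hom_comm_apply ρ.coindι (n : G) m).trans ?_
    rw [hm]
    exact hy n
  · rintro ⟨v, hv⟩
    obtain ⟨w, hw, hwv⟩ := (isSES_coind_restrict N ρ).exists_invariant_lift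
      (subsingleton_coind_restrict N ρ 0) h1 v ((mem_invariants _).2 fun n => hv n)
    exact ⟨⟨w, fun n => (mem_invariants _).1 hw n⟩, Subtype.ext hwv⟩

end Invariants

/-! ### The Tower Theorem -/

section Tower

variable {G : Type u} [Group G] [TopologicalSpace G] [IsTopologicalGroup G] [CompactSpace G]
  [T2Space G] [TotallyDisconnectedSpace G]
variable (N : Subgroup G) [N.Normal] [hN : IsClosed (N : Set G)]

omit [TotallyDisconnectedSpace G] in
/-- `Hⁿ⁺¹(G, C(G, M)) = 0` for the coinduced discrete module. [cite: Shatz1972, Ch. II §2 Thm. 8] -/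
theorem subsingleton_coind {M : Type u} [AddCommGroup M] [TopologicalSpace M] [DiscreteTopology M]
    (ρ : ContinuousRep G ℤ M) (n : ℕ) :
    Subsingleton (continuousCohomology (n + 1) ρ.coind.toTopRep) :=
  haveI := subsingleton_continuousCohomology_coind₁ ρ.toTopRep n
  subsingleton_continuousCohomology_of_iso ρ.coindIso.symm (n + 1)

/-- **Degenerate Hochschild–Serre** (the case `cd_p(N) = 0` of the Tower Theorem; Shatz II §4
(25): edge isomorphisms when `E₂^{i,j} = 0` for `j > 0`): if the discrete `G`-module `M` is
`N`-acyclic (`Hʲ(N, M) = 0` for all `j ≥ 1`), then `H^{k+1}(G ⧸ N, M^N) = 0` implies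
`H^{k+1}(G, M) = 0`. Proof by dimension shifting `M ↦ Q = C(G, M)/M` on both sides: `Q` is again
`N`-acyclic, `0 → M^N → C(G,M)^N → Q^N → 0` is exact with acyclic middle term, and in degree
one both `H¹` are the cokernel of `C(G, M)^G → Q^G`. [cite: Shatz1972, Ch. II §4 (24)–(25) and Ch. III §1 Thm. 13 (proof)] -/
theorem subsingleton_of_nAcyclic :
    ∀ (k : ℕ) {M : Type u} [AddCommGroup M] [TopologicalSpace M] [DiscreteTopology M]
      (ρ : ContinuousRep G ℤ M),
      (∀ n, Subsingleton
        (continuousCohomology (n + 1) ((ρ.restrict (subgroupIncl N)).toTopRep))) →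
      Subsingleton (continuousCohomology (k + 1) (ρ.quotientInvariants N).toTopRep) →
      Subsingleton (continuousCohomology (k + 1) ρ.toTopRep)
  | 0, M, _, _, _, ρ, hNA, hGN => by
    refine (isSES_coind ρ).subsingleton_one (subsingleton_coind ρ 0) fun v hv => ?_
    -- `v ∈ Q^G`, seen in `(Q^N)^{G/N}`
    have hvN : v ∈ ρ.coindQuot.invariantsOf N := fun n => (mem_invariants _).1 hv (n : G)
    have hv' : (⟨v, hvN⟩ : ρ.coindQuot.invariantsOf N) ∈
        (ρ.coindQuot.quotientInvariants N).toTopRep.ρ.invariants := by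
      refine (mem_invariants _).2 fun c => ?_
      induction c using QuotientGroup.induction_on with
      | H g => exact Subtype.ext ((mem_invariants _).1 hv g)
    obtain ⟨w, hw, hwv⟩ := (isSES_invariants N ρ (hNA 0)).exists_invariant_lift
      (subsingleton_coind_invariants N ρ 0) hGN ⟨v, hvN⟩ hv'
    refine ⟨w.1, (mem_invariants _).2 fun g => ?_, congrArg Subtype.val hwv⟩
    exact congrArg Subtype.val ((mem_invariants _).1 hw (g : G ⧸ N))
  | k + 1, M, _, _, _, ρ, hNA, hGN => by
    -- `Q` is `N`-acyclic
    have hQ : ∀ n, Subsingleton (continuousCohomology (n + 1)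
        ((ρ.coindQuot.restrict (subgroupIncl N)).toTopRep)) := fun n =>
      (isSES_coind_restrict N ρ).subsingleton_X₃ n (subsingleton_coind_restrict N ρ n) (hNA (n + 1))
    -- `H^{k+1}(G ⧸ N, Q^N) = 0`
    have hQN : Subsingleton
        (continuousCohomology (k + 1) (ρ.coindQuot.quotientInvariants N).toTopRep) :=
      (isSES_invariants N ρ (hNA 0)).subsingleton_X₃ k (subsingleton_coind_invariants N ρ k) hGN
    exact (isSES_coind ρ).subsingleton_X₁ k (subsingleton_of_nAcyclic k ρ.coindQuot hQ hQN)
      (subsingleton_coind ρ (k + 1))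

/-- **The Tower Theorem, inductive form**: if `cd_p(G ⧸ N) ≤ b`, then for every discrete
`p`-primary `G`-module `M` with `Hʲ(N, M) = 0` for all `j > a` one has `H^q(G, M) = 0` for all
`q > a + b`. Induction on `a`: the base case is `subsingleton_of_nAcyclic` (with
`H^{q}(G ⧸ N, M^N) = 0` from `cd_p(G ⧸ N) ≤ b`, `M^N` being `p`-primary); the step replaces `M` by
`Q = C(G, M)/M`, for which `Hʲ(N, Q) ≅ Hʲ⁺¹(N, M)` (`C(G, M)` is `N`-acyclic) and
`H^{q-1}(G, Q) ↠ H^q(G, M)`. [cite: Shatz1972, Ch. III §1 Thm. 13 (Tower Theorem)] -/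
theorem subsingleton_of_cdN {p : ℕ} [Fact p.Prime] {b : ℕ} (hGN : GroupCdLE (G ⧸ N) p b) :
    ∀ (a : ℕ) {M : Type u} [AddCommGroup M] [TopologicalSpace M] [DiscreteTopology M]
      (ρ : ContinuousRep G ℤ M), IsPrimaryTorsion p M →
      (∀ n, a ≤ n → Subsingleton
        (continuousCohomology (n + 1) ((ρ.restrict (subgroupIncl N)).toTopRep))) →
      ∀ q, a + b < q → Subsingleton (continuousCohomology q ρ.toTopRep)
  | 0, M, _, _, _, ρ, hM, hNA, q, hq => by
    obtain ⟨k, rfl⟩ : ∃ k, q = k + 1 := ⟨q - 1, by omega⟩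
    refine subsingleton_of_nAcyclic N k ρ (fun n => hNA n (Nat.zero_le n)) ?_
    exact hGN (ρ.invariantsOf N) (ρ.quotientInvariants N) (hM.submodule _) (by omega)
  | a + 1, M, _, _, _, ρ, hM, hNA, q, hq => by
    obtain ⟨k, rfl⟩ : ∃ k, q = k + 2 := ⟨q - 2, by omega⟩
    have hQ : ∀ n, a ≤ n → Subsingleton (continuousCohomology (n + 1)
        ((ρ.coindQuot.restrict (subgroupIncl N)).toTopRep)) := fun n hn =>
      (isSES_coind_restrict N ρ).subsingleton_X₃ n (subsingleton_coind_restrict N ρ n)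
        (hNA (n + 1) (by omega))
    exact (isSES_coind ρ).subsingleton_X₁ k
      (subsingleton_of_cdN hGN a ρ.coindQuot (hM.continuousMap.quotient _) hQ (k + 1) (by omega))
      (subsingleton_coind ρ (k + 1))

end Tower

/-- **The Tower Theorem** (Shatz III §1 Thm. 13 = Serre I §3.3 Prop. 15), discharging the named
fact `tower_groupCdLE_of_isClosed_normal`: for a profinite group `G`, a closed normal subgroup
`N` and a prime `p`, `cd_p(N) ≤ a` and `cd_p(G/N) ≤ b` imply `cd_p(G) ≤ a + b`.
[cite: Shatz1972, Ch. III §1 Thm. 13 (Tower Theorem)] [cite: SerreGaloisCohomology1997, I §3.3 Prop. 15] -/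
theorem tower_groupCdLE_of_isClosed_normal_holds : tower_groupCdLE_of_isClosed_normal.{u} := by
  intro G _ _ _ _ _ _ N _ hN p _ a b hNcd hGNcd M _ _ _ ρ hM q hq
  haveI : IsClosed (N : Set G) := hN
  refine subsingleton_of_cdN N hGNcd a ρ hM (fun n hn => ?_) q hq
  exact hNcd M (ρ.restrict (subgroupIncl N)) hM (by omega)


end Literature.NumberTheory.GaloisRepresentations

end
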